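import Summits.ResolutionOfSingularities.ResolutionOfSingularities.Theorems.ExitLawWalks
import Summits.ResolutionOfSingularities.ResolutionOfSingularities.Theorems.ProximityCutKernels
import HarnessLib

/-!
# ExitLawClasses — §4 pieces and §5 kernels of the decomp-res node «ExitLaw» (lens-5 g15, sha256
fd5076a831344d35; critic row 119
CLEARED: DECIDED +1 (cell `NoMasslessProximityLineDeep`), MAP +1 (exit law + two-column fusion +
excess/proximity/translation cuts))

Tree file 3/4, route-independent: the NEW classes `NoFrozenPlateauxDeep`, `NoExcessPlateauxDeep`,
`NoRepeatRecurrentExcessPlateauxDeep`, `NoRepeatTranslationRecurrentExcessPlateauxDeep` and every kernel/cut among the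
tree classes (`noPlateau_iff_frozen_excess`, the BRIDGE `noFrozen_of_freeTails`, `noBare_of_freeTails`, the DECIDED cell
`noMasslessProximityLine_holds : ProximityCut.NoMasslessProximityLineDeep`, `noRecurrentProximity_of_sat`, the two-column cut
`defectDeep_iff_arc_sat`, `noRepeatExcess_of_noExcess`, `noExcess_of_freeTails_repeat`, (`NoJump.noRecurrentJumpWalksDeep_holds` cited),
`noJoint_of_noRepeatExcess`) — VERBATIM.  The kernels that reach the host 31770 `MaxContactCut.DefectWalksDeep` BY NAME
(`closes*`, `defectWalksDeep_iff_*`) and the `NoOriginTails` join are in `MaxContactCutExitLaw` (file 4/4).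
[WRITER NOTE (decomp-res writer g5): the verbatim restatements of lens-3 g12's `NoFreePointTails`, `NoFreePointTailsDeep`,
`NoRecurrentProximityDeep`, `NoMasslessProximityLineDeep` and of the kernels `freeTailsDeep_of_all` / `freeTailsDeep_of_defect`
are deleted — they are the tree's `ProximityCutClasses` / `ProximityCutKernels` decls (namespace `ProximityCut`, opened);
`noMasslessProximityLine_holds` is thereby retargeted at `ProximityCut.NoMasslessProximityLineDeep` (critic row 119 r1).]
(Sources: Hauser2010 §§F–G; HauserPerlega2019 §3; CossartPiltant2019; CossartJannsenSaito2020.)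
-/

open MvPolynomial Finset
open scoped BigOperators
open Literature.AlgebraicGeometry.Resolution
open Literature.AlgebraicGeometry.Resolution.Hauser2010
open Literature.AlgebraicGeometry.Resolution.PointBlowup
open Literature.AlgebraicGeometry.Resolution.WeightedBlowup
open Literature.Barriers.ResolutionOfSingularities
open Summit.ResolutionOfSingularities.ResolutionOfSingularities.Theorems.TightDefectClasses
open Summit.ResolutionOfSingularities.ResolutionOfSingularities.Theorems.TightDefectStrongWalks
open Summit.ResolutionOfSingularities.ResolutionOfSingularities.Theorems.ItineraryCutClasses
open Summit.ResolutionOfSingularities.ResolutionOfSingularities.Theorems.BoundaryLedger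
open Summit.ResolutionOfSingularities.ResolutionOfSingularities.Theorems.ProximityCut

namespace Summit.ResolutionOfSingularities.ResolutionOfSingularities.Theorems.ExitLaw

/-! ## §4 The pieces (typed over the tree's classes; host 31770 BY NAME through `MaxContactCut.DefectWalksDeep`) -/

/-- PIECE · THE BASE RANGE OF THE EXCESS AXIS — FROZEN PLATEAUX (NEW CLASS) · WEAKER than 31770 (NECESSARY:
`noFrozen_of_noPlateau`) · DECIDED-MOD-PORT: `⟸ NoFreePointTailsDeep` (`noFrozen_of_freeTails`, PROVED: absorption +
exit law make every frozen plateau newest-free); its two-loaded-components sub-cell PROVED EMPTY outright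
(`no_frozen_two_components`): no infinite deep defect walk whose shade is eventually constant passes, on the
plateau, through a state of order exactly `q = p^e`. -/
def NoFrozenPlateauxDeep : Prop :=
  ∀ p : ℕ, p.Prime → ∀ e : ℕ, 2 ≤ e → ∀ (K : Type) [Field K] [CharP K p] [PerfectField K] [DecidableEq K]
    (s₀ : State (Fin 3) K), IsRoot (p ^ e) s₀ → ∀ W : ForcedWalk (p ^ e) s₀, (∀ i, 1 ≤ (W.st i).shade) →
    ∀ N : ℕ, (∀ t, N ≤ t → (W.st (t + 1)).shade = (W.st t).shade) →
    ∀ t, N ≤ t → ordZero (W.st t).F = ((p ^ e : ℕ) : ℕ∞) → False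

/-- PIECE · THE ASYMPTOTIC RANGE OF THE EXCESS AXIS — POSITIVE-EXCESS PLATEAUX (NEW CLASS) = THE LOCATED RESIDUAL of
31770 after g14 (`NoRecurrentJumpWalksDeep`, PROVED) and the arc law · WEAKER than 31770 (NECESSARY:
`noExcess_of_noPlateau`) · UNDECIDED · score 0 · INSTRUMENTABLE (census T-plateau-1: 22 % of the `(2,4)` and 44 % of
the `(3,9)` root-bed plateaux of length `≥ 4` keep `o > q`) · IDEA-NEEDED: no infinite deep defect walk has
eventually constant shade while its order stays `≥ q + 1` (excess `m_t = o_t − q ∈ [1, q−1]`, fresh mass every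
move). -/
def NoExcessPlateauxDeep : Prop :=
  ∀ p : ℕ, p.Prime → ∀ e : ℕ, 2 ≤ e → ∀ (K : Type) [Field K] [CharP K p] [PerfectField K] [DecidableEq K]
    (s₀ : State (Fin 3) K), IsRoot (p ^ e) s₀ → ∀ W : ForcedWalk (p ^ e) s₀, (∀ i, 1 ≤ (W.st i).shade) →
    ∀ N : ℕ, (∀ t, N ≤ t → (W.st (t + 1)).shade = (W.st t).shade) →
    (∀ t, N ≤ t → ordZero (W.st t).F ≠ ((p ^ e : ℕ) : ℕ∞)) → False

/-- PIECE · THE LOCATED RESIDUAL OF 31770 AFTER g15 — REPEAT-RECURRENT POSITIVE-EXCESS PLATEAUX (NEW CLASS) · WEAKER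
than 31770 (NECESSARY: `noRepeatExcess_of_noExcess ∘ noExcess_of_noPlateau`) · UNDECIDED · score 0 · IDEA-NEEDED
(attack handle: the POWER LAW AT REPEATS of `NEXT-g16.md` — a repeat after a state of excess `m` forces the initial
form of the `u_j^m`-layer of `F'` to be `g·ℓ^{q−m}`) · INSTRUMENTABLE (census T-plateau-1 / T-dense-1: letters `S`
on the `o > q` plateaux): no infinite deep defect walk has eventually constant shade, order `≥ q + 1` at every
late time, AND infinitely many proximity repeats (each of which is then a satellite move keeping the fresh
component of mass `m_t ≥ 1`, `satellite_of_staysOnNewest`).  Its complement inside the excess plateaux —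
eventually newest-free excess plateaux — lies in the arc-law class (`noExcess_of_freeTails_repeat`). -/
def NoRepeatRecurrentExcessPlateauxDeep : Prop :=
  ∀ p : ℕ, p.Prime → ∀ e : ℕ, 2 ≤ e → ∀ (K : Type) [Field K] [CharP K p] [PerfectField K] [DecidableEq K]
    (s₀ : State (Fin 3) K), IsRoot (p ^ e) s₀ → ∀ W : ForcedWalk (p ^ e) s₀, (∀ i, 1 ≤ (W.st i).shade) →
    ∀ N : ℕ, (∀ t, N ≤ t → (W.st (t + 1)).shade = (W.st t).shade) →
    (∀ t, N ≤ t → ordZero (W.st t).F ≠ ((p ^ e : ℕ) : ℕ∞)) → (∀ M : ℕ, ∃ t, M ≤ t ∧ StaysOnNewest W t) → False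

/-! ## §5 Kernels and cuts (all PROVED) -/

/-- Necessity of the frozen piece. [folklore] -/
theorem noFrozen_of_noPlateau (h : NoPlateauWalksDeep) : NoFrozenPlateauxDeep :=
  fun p hp e he K _ _ _ _ s₀ hs W hW N hN _ _ _ => h p hp e he K s₀ hs W hW ⟨N, hN⟩

/-- Necessity of the excess piece. [folklore] -/
theorem noExcess_of_noPlateau (h : NoPlateauWalksDeep) : NoExcessPlateauxDeep :=
  fun p hp e he K _ _ _ _ s₀ hs W hW N hN _ => h p hp e he K s₀ hs W hW ⟨N, hN⟩

/-- **THE EXCESS CUT OF THE PLATEAU HALF (EXACT, PROVED)**: a plateau either meets order `q` (frozen) or keeps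
positive excess for ever. [folklore] -/
theorem noPlateau_iff_frozen_excess : NoPlateauWalksDeep ↔ NoFrozenPlateauxDeep ∧ NoExcessPlateauxDeep := by
  refine ⟨fun h => ⟨noFrozen_of_noPlateau h, noExcess_of_noPlateau h⟩, fun ⟨hF, hX⟩ => ?_⟩
  intro p hp e he K _ _ _ _ s₀ hs W hW hstall
  obtain ⟨N, hN⟩ := hstall
  by_cases hex : ∃ t, N ≤ t ∧ ordZero (W.st t).F = ((p ^ e : ℕ) : ℕ∞)
  · obtain ⟨t, ht, ho⟩ := hex
    exact hF p hp e he K s₀ hs W hW N hN t ht ho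
  · push Not at hex
    exact hX p hp e he K s₀ hs W hW N hN hex

/-- **THE BRIDGE (PROVED)**: the arc law decides the frozen plateaux (absorption + exit law ⇒ newest-free tail). [folklore] -/
theorem noFrozen_of_freeTails (h : NoFreePointTailsDeep) : NoFrozenPlateauxDeep := by
  intro p hp e he K _ _ _ _ s₀ hs W hW N hN t ht ho
  exact h p hp e he K s₀ hs W hW t (leaves_of_frozen hs W ht hN ho)

/-- g11's BARE LINE is inside the arc-law class (PROVED; no plateau hypothesis needed: order `q` at every late time
forces the letter `F` at every late move). [folklore] -/
theorem noBare_of_freeTails (h : NoFreePointTailsDeep) : NoBareTailsDeep := by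
  intro p hp e he K _ _ _ _ s₀ hs W hW N hN
  exact h p hp e he K s₀ hs W hW N fun t ht => leavesNewest_of_order_eq hs W t (hN t ht).2

/-- **THE MASSLESS PROXIMITY LINE IS EMPTY (PROVED)** — lens-3 g12's located sub-residual DECIDED. [folklore] -/
theorem noMasslessProximityLine_holds : NoMasslessProximityLineDeep := by
  intro p hp e he K _ _ _ _ s₀ hs W _ hfree hrec
  obtain ⟨N, hN⟩ := hfree
  obtain ⟨t, ht, hS⟩ := hrec N
  exact hN (t + 1) (by omega) (satellite_of_staysOnNewest hs W t hS)

/-- lens-3's residual is inside g11's satellite column (PROVED): recurrent proximity repeats are recurrent satellite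
moves. [folklore] -/
theorem noRecurrentProximity_of_sat (h : SatDefectWalksTerminateDeep) : NoRecurrentProximityDeep := by
  intro p hp e he K _ _ _ _ s₀ hs W hW hrec
  refine h p hp e he K s₀ hs W hW fun N => ?_
  obtain ⟨t, ht, hS⟩ := hrec N
  exact ⟨t + 1, by omega, satellite_of_staysOnNewest hs W t hS⟩

/-- **THE TWO-COLUMN CUT OF 31770 (EXACT, PROVED, hypothesis-free)**: an infinite deep defect walk is eventually
newest-free (arc-law column) or makes infinitely many proximity repeats, hence infinitely many satellite moves
(g11's satellite column).  Both g11's bare line and lens-3's massless line have dropped out. [folklore] -/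
theorem defectDeep_iff_arc_sat : DefectWalksTerminateDeep ↔ NoFreePointTailsDeep ∧ SatDefectWalksTerminateDeep := by
  refine ⟨fun h => ⟨freeTailsDeep_of_defect h, (defectDeep_iff_plateau_sat.mp h).2⟩, fun ⟨hA, hS⟩ => ?_⟩
  intro p hp e he K _ _ _ _ s₀ hs W hW
  by_cases hrec : ∀ N, ∃ t, N ≤ t ∧ StaysOnNewest W t
  · exact noRecurrentProximity_of_sat hS p hp e he K s₀ hs W hW hrec
  · push Not at hrec
    obtain ⟨N, hN⟩ := hrec
    exact hA p hp e he K s₀ hs W hW N fun t ht => (leavesNewest_iff_not_stays W t).mpr (hN t ht)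

/-- Necessity of the residual inside the excess piece (instantiation). [folklore] -/
theorem noRepeatExcess_of_noExcess (h : NoExcessPlateauxDeep) : NoRepeatRecurrentExcessPlateauxDeep :=
  fun p hp e he K _ _ _ _ s₀ hs W hW N hN hex _ => h p hp e he K s₀ hs W hW N hN hex

/-- **THE PROXIMITY CUT OF THE EXCESS PIECE (PROVED)**: an excess plateau is eventually newest-free (arc-law class) or
repeat-recurrent (the residual). [folklore] -/
theorem noExcess_of_freeTails_repeat (hA : NoFreePointTailsDeep) (hR : NoRepeatRecurrentExcessPlateauxDeep) :
    NoExcessPlateauxDeep := by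
  intro p hp e he K _ _ _ _ s₀ hs W hW N hN hex
  by_cases hrec : ∀ M : ℕ, ∃ t, M ≤ t ∧ StaysOnNewest W t
  · exact hR p hp e he K s₀ hs W hW N hN hex hrec
  · push Not at hrec
    obtain ⟨M, hM⟩ := hrec
    exact hA p hp e he K s₀ hs W hW M fun t ht => (leavesNewest_iff_not_stays W t).mpr (hM t ht)

/-! ## §6 (rev 1) The recurrent-jump half DISCHARGED BY NAME from the tree, and the JOIN with the translation axis

The tree's `Theorems/NoJump.lean` (lens-5 g14, landed 2026-08-30) proves `NoRecurrentJumpWalksDeep`; the kernel loses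
that hypothesis.  Lens-3's `NoOriginTails` (g12, PROVED in HOME `ProximityCut.lean`; restated VERBATIM, hypothesis
here) kills every walk with only finitely many translated moves, so the residual shrinks once more, EXACTLY, to the
plateaux that are excess AND repeat-recurrent AND translation-recurrent — the INTERSECTION of this seat's residual
with lens-3 g14's translation-recurrent `NoHighPlateauxDeep(Two)` (same host, co-booked). -/

-- [WRITER NOTE (decomp-res writer g5): the lens's `noRecurrentJump_holds` is the tree's
-- `NoJump.noRecurrentJumpWalksDeep_holds` (gate dedup) — cited by name downstream, not restated.]

/-- PIECE · THE JOINT LOCATED RESIDUAL OF 31770 (rev 1; NEW CLASS) — positive-excess plateaux that are BOTH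
repeat-recurrent (infinitely many proximity repeats, each a satellite move of fresh mass `m_t ≥ 1`) AND
translation-recurrent (infinitely many translated moves `b_t ≠ 0`) · WEAKER than 31770 and than
`NoRepeatRecurrentExcessPlateauxDeep` by letter (`noJoint_of_noRepeatExcess`) · UNDECIDED · score 0 · IDEA-NEEDED
(power law at repeats + exit-depth law, `NEXT-g16.md`) · INSTRUMENTABLE (T-excess-0: EMPTY on the census root beds at
depth 10; census T-high-0: translated excess steps drop the shade within two states in ≥ 83 %). -/
def NoRepeatTranslationRecurrentExcessPlateauxDeep : Prop :=
  ∀ p : ℕ, p.Prime → ∀ e : ℕ, 2 ≤ e → ∀ (K : Type) [Field K] [CharP K p] [PerfectField K] [DecidableEq K]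
    (s₀ : State (Fin 3) K), IsRoot (p ^ e) s₀ → ∀ W : ForcedWalk (p ^ e) s₀, (∀ i, 1 ≤ (W.st i).shade) →
    ∀ N : ℕ, (∀ t, N ≤ t → (W.st (t + 1)).shade = (W.st t).shade) →
    (∀ t, N ≤ t → ordZero (W.st t).F ≠ ((p ^ e : ℕ) : ℕ∞)) → (∀ M : ℕ, ∃ t, M ≤ t ∧ StaysOnNewest W t) →
    (∀ M : ℕ, ∃ t, M ≤ t ∧ W.b t ≠ 0) → False

/-- The joint residual is weaker than the g15 residual by letter. [folklore] -/
theorem noJoint_of_noRepeatExcess (h : NoRepeatRecurrentExcessPlateauxDeep) :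
    NoRepeatTranslationRecurrentExcessPlateauxDeep :=
  fun p hp e he K _ _ _ _ s₀ hs W hW N hN hex hrec _ => h p hp e he K s₀ hs W hW N hN hex hrec


end Summit.ResolutionOfSingularities.ResolutionOfSingularities.Theorems.ExitLaw
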